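import Summits.Ventures.PercRepro.Night4TrT1C2Q5M0P0
import Summits.Ventures.PercRepro.Night4TrT1C2Q5M0T

/-!
# PercRepro — the `(8, 6)` trace sum at type `1` on a rank-`5` subset of the core, corank `2`, `m(G) = 0`: the certificate (night-4 gen 4)
The facts of the cyclic-rank profile (P1)–(P3), the line facts (L1)–(L5), the weighted rises (L4), the demand-free levels
`0 … 0` at type `1`, and the facts of the core (lines `≤ 3` points, planes `≤ 6`, solids `≤ 10`, rank-`5` flats `≤ 21`),
instantiated in `ℚ`, and the exact dual certificate of the profile LP (`mining/night-4/g4/leanlp_q.py`, night-2's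
`leanlp_t.py` with the rank-`5` flat row) checked by `linear_combination`.
-/
namespace PercRepro.Night4

open Finset ThmH SixFour GenQ PerFlat Star

variable {α : Type*} [DecidableEq α] {M : Matroid α} [M.Finite]

/-- **the `(8, 6)` trace sum at type `1` on a rank-`5` subset of the core, corank `2`, `m(G) = 0`**: the exact dual certificate, `7·TS ≥ 649/20`. -/
theorem traceSum_nonneg_t1_c2_q5_m0 (hs : Simple M) (hline : ∀ L ∈ flatsQ M 2, L.card ≤ 3) (hplane : ∀ P ∈ flatsQ M 3, P.card ≤ 6) (hsolid : ∀ F ∈ flatsQ M 4, F.card ≤ 10) (hflat5 : ∀ F ∈ flatsQ M 5, F.card ≤ 21) {G : Finset α} (hG : G ⊆ gr M) (hrG : M.eRk (G : Set α) = ((5 : ℕ) : ℕ∞)) (hcard : G.card = 5 + 2) (hmG : mTr M G = 0) : 0 ≤ ∑ B ∈ Rq M G 5, ((((5 + 1 : ℕ) : ℚ) + 2 - ((1 : ℕ) : ℚ)) * (1 / (2 + (mTr M B : ℚ))) - ((((5 + 1 : ℕ) : ℚ) + 2) / (((5 + 1 : ℕ) : ℚ) + 1)) * GenQ.dem M G 1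 B) := by
  have hpos : (0 : ℚ) < ((5 : ℕ) : ℚ) + 2 := by norm_num
  suffices hmain : 0 ≤ (((5 : ℕ) : ℚ) + 2) * ∑ B ∈ Rq M G 5, ((((5 + 1 : ℕ) : ℚ) + 2 - ((1 : ℕ) : ℚ)) * (1 / (2 + (mTr M B : ℚ))) - ((((5 + 1 : ℕ) : ℚ) + 2) / (((5 + 1 : ℕ) : ℚ) + 1)) * GenQ.dem M G 1 B) from
    le_of_mul_le_mul_left (by rw [mul_zero]; exact hmain) hpos
  have e_0_5 : Finset.Icc (0 : ℕ) 5 = {0, 1, 2, 3, 4, 5} := by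
    ext x; simp only [Finset.mem_Icc, Finset.mem_insert, Finset.mem_singleton]; omega
  have hsum : ∀ f : ℕ → ℚ, ∑ m ∈ Finset.Icc (0 : ℕ) 5, f m = f 0 + f 1 + f 2 + f 3 + f 4 + f 5 := by
    intro f
    rw [e_0_5, Finset.sum_insert (by simp), Finset.sum_insert (by simp), Finset.sum_insert (by simp), Finset.sum_insert (by simp), Finset.sum_insert (by simp), Finset.sum_singleton]
    ring
  rw [traceSum_mul_succ_eq_profile hG hrG hcard 1, hmG]
  simp only [hsum, Finset.sum_range_succ, Finset.sum_range_zero]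
  push_cast
  norm_num
  have t0 := trt1c2_q5_m0_cert_0 hs hline hplane hsolid hflat5 hG hrG hcard hmG
  have t1 := trt1c2_q5_m0_cert_1 hs hline hplane hsolid hflat5 hG hrG hcard hmG
  have ttop := trt1c2_q5_m0_cert_top hs hline hplane hsolid hflat5 hG hrG hcard hmG
  linear_combination t0 + t1 + ttop

end PercRepro.Night4
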